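import Summits.RiemannHypothesis.RiemannHypothesis.Theorems.JensenPolynomialsPhiLogDeriv34
import Summits.RiemannHypothesis.RiemannHypothesis.Theorems.JensenPolynomialsPhiThetaTails6
import HarnessLib

/-!
# Route `JensenPolynomials`, far skewness crux `XiCumulantSkew98Far` — the envelopes of `ψ‴`, `ψ⁗`: algebraic cores
(RH-FREE; cell rh-jensen, HUMAN RULING D-0040 / D-0074)

LINE 1 (D-0074 framing): everything here is RH-FREE real analysis of the Pólya–de Bruijn kernel `Φ = deBruijnPhi`;
nothing in this file bears on the zeros of `ζ` or is progress toward RH.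

Third piece of the (E3)/(E4) chain of BLUEPRINT-19216 §5 (HOME memo `eng-5/stein/BLUEPRINT-19216.md` of the cell):
the two ALGEBRAIC CORES. With `y = πe^{4u} ≥ 1267.4` and the normalised one-series values
`s_m = e^{y}·∑_n P_m(y_n)e^{−y_n}` of `Φ^{(m)}/eᵘ` (`m = 0, …, 4`; `s₁` for `−Φ′`), the tails give
`|s_m − P_m(y)| ≤ θ·4^m·2·y^{m+2}` with `θ = (64/63)4⁶e^{−3y}`, `θy⁷ ≤ 10⁻⁶` (toolbox files
`JensenPolynomialsPhiLogDeriv34.lean`, `JensenPolynomialsPhiThetaTails6.lean`). Here we prove, for ANY reals with these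
properties (`θ ≥ 0`, `θy⁷ ≤ 10⁻⁶`, the `Φ`-tail nonnegative):

* `envelope₃_core`: `64y(1 − 10⁻⁶)s₀³ ≤ N₃(s) ≤ 64y·s₀³`, `N₃(s) = −s₀²s₃ − 3s₀s₁s₂ + 2s₁³` (`= ψ‴Φ³·e^{3y−3u}`);
* `envelope₄_core`: `256y·s₀⁴ ≤ N₄(s) ≤ 256y(1 + 10⁻⁶)s₀⁴`,
  `N₄(s) = 6s₁⁴ − 12s₀s₁²s₂ + 3s₀²s₂² − 4s₀²s₁s₃ − s₀³s₄` (`= ψ⁗Φ⁴·e^{4y−4u}`).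

Mechanism: the HEAD identities (exact, `ring`) `N₃(P) = 64y⁴(2y − 3)³ − 384y⁴(2y + 3)` and
`N₄(P) = 256y⁵(2y − 3)⁴ + 1536y⁵(4y² + 24y + 9)` — i.e. `−(log a₁)‴ = 64y − 384y(2y+3)/(2y−3)³` and
`−(log a₁)⁗ = 256y + 1536y(4y²+24y+9)/(2y−3)⁴` for the first theta term `a₁ = eᵘ(2y² − 3y)e^{−y}` (Coffey–Csordas
(2.9)); the head corrections fit in `10⁻⁶·64y`, `10⁻⁶·256y` once `6(2y + 3) ≤ 10⁻⁶(2y − 3)³` and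
`6(4y² + 24y + 9) ≤ 10⁻⁶(2y − 3)⁴`, true from `y ≥ 1267.4` (`πe⁶`) with 6 % to spare; the tails are absorbed through
the generic product-perturbation lemmas (`|∏(a+t) − ∏a| ≤ (2^k − 1)θ∏B`), of total size `21504θy⁹`, `1597440θy¹²`.

WHAT THIS IS NOT: not a statement about `ξ`'s zeros. References: M. W. Coffey, G. Csordas, Math. Comp. 82 (2013),
(2.8)–(2.11) [CoffeyCsordas2013]; G. Csordas, T. S. Norfolk, R. S. Varga, Trans. AMS 296 (1986) §3 [CsordasNorfolkVarga1986].
-/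

noncomputable section

open Filter Set
open scoped Real Topology

-- D-0017: `Summit.RiemannHypothesis.RiemannHypothesis.…` duplicates the namespace BY DESIGN (single-problem summit).
set_option linter.dupNamespace false

namespace Summit.RiemannHypothesis.RiemannHypothesis.Theorems.JensenPolynomials

open Literature.NumberTheory.LFunctions


/-- **(E3), algebraic core.** With `y ≥ 1267.4`, a tail scale `θ ≥ 0` with `θy⁷ ≤ 10⁻⁶`, and normalised series values
`s_m` within `θ·4^m·2·y^{m+2}` of the heads `P₀ = 2y² − 3y`, `−P₁ = 8y³ − 30y² + 15y`, `P₂`, `P₃` (the `Φ`-tail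
nonnegative): `64y(1 − 10⁻⁶)·s₀³ ≤ N₃(s) ≤ 64y·s₀³` for `N₃(s) = −s₀²s₃ − 3s₀s₁s₂ + 2s₁³`
(head identity `N₃(P) = 64y⁴(2y − 3)³ − 384y⁴(2y + 3)`). -/
theorem envelope₃_core {y θ s₀ s₁ s₂ s₃ : ℝ} (hy : 1267.4 ≤ y) (hθ0 : 0 ≤ θ)
    (hθ7 : θ * y ^ 7 ≤ 1 / 10 ^ 6)
    (ht₀0 : 0 ≤ s₀ - (2 * y ^ 2 - 3 * y)) (ht₀ : s₀ - (2 * y ^ 2 - 3 * y) ≤ θ * (2 * y ^ 2))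
    (ht₁ : |s₁ - (8 * y ^ 3 - 30 * y ^ 2 + 15 * y)| ≤ θ * (8 * y ^ 3))
    (ht₂ : |s₂ - (32 * y ^ 4 - 224 * y ^ 3 + 330 * y ^ 2 - 75 * y)| ≤ θ * (32 * y ^ 4))
    (ht₃ : |s₃ - (-128 * y ^ 5 + 1440 * y ^ 4 - 4232 * y ^ 3 + 3270 * y ^ 2 - 375 * y)| ≤ θ * (128 * y ^ 5)) :
    64 * y * (1 - 1 / 10 ^ 6) * s₀ ^ 3 ≤ -(s₀ ^ 2 * s₃) - 3 * s₀ * s₁ * s₂ + 2 * s₁ ^ 3 ∧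
      -(s₀ ^ 2 * s₃) - 3 * s₀ * s₁ * s₂ + 2 * s₁ ^ 3 ≤ 64 * y * s₀ ^ 3 := by
  set a₀ := 2 * y ^ 2 - 3 * y with ha₀
  set a₁ := 8 * y ^ 3 - 30 * y ^ 2 + 15 * y with ha₁
  set a₂ := 32 * y ^ 4 - 224 * y ^ 3 + 330 * y ^ 2 - 75 * y with ha₂
  set a₃ := -128 * y ^ 5 + 1440 * y ^ 4 - 4232 * y ^ 3 + 3270 * y ^ 2 - 375 * y with ha₃
  have hπ := Real.pi_lt_d2
  have hy1 : 1 ≤ y := by linarith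
  have hy0 : 0 ≤ y := by linarith
  have hz : 4 * π ≤ y := by linarith
  -- small numerical facts
  have hy7 : 1 ≤ y ^ 7 := one_le_pow₀ hy1
  have hθ1 : θ ≤ 1 := by nlinarith only [hθ7, hy7, hθ0]
  have hy2 : 0 ≤ y ^ 2 := sq_nonneg y
  have hy4 : 0 ≤ y ^ 4 := by positivity
  have hy04 : 1 ≤ y ^ 4 := one_le_pow₀ hy1
  have hy25 : y ^ 2 ≤ y ^ 5 := pow_le_pow_right₀ hy1 (by norm_num)
  have hθ9 : θ * y ^ 9 ≤ 1 / 10 ^ 6 * y ^ 2 :=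
    calc θ * y ^ 9 = θ * y ^ 7 * y ^ 2 := by ring
      _ ≤ 1 / 10 ^ 6 * y ^ 2 := mul_le_mul_of_nonneg_right hθ7 hy2
  have hθ70 : 0 ≤ θ * y ^ 7 := by positivity
  have he0 : 0 ≤ θ * (2 * y ^ 2) := by positivity
  have he2 : θ * (2 * y ^ 2) ≤ 2 * y ^ 2 := by nlinarith only [hθ1, hy2]
  have ha0 : 0 ≤ a₀ := by
    have : 0 ≤ y * (2 * y - 3) := mul_nonneg hy0 (by linarith)
    rw [ha₀]; linarith
  have ha2 : a₀ ≤ 2 * y ^ 2 := by rw [ha₀]; linarith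
  have hs0 : 0 ≤ s₀ := by linarith
  -- head sizes
  have hB₀ : |a₀| ≤ 2 * y ^ 2 := by
    have h := abs_P0_le hz; rw [ha₀]; convert h using 2; ring
  have hB₁ : |a₁| ≤ 8 * y ^ 3 := by
    have h := abs_P1_le hz; rw [ha₁]; convert h using 2; ring
  have hB₂ : |a₂| ≤ 32 * y ^ 4 := by
    have h := abs_P2_le hz; rw [ha₂]; convert h using 2; ring
  have hB₃ : |a₃| ≤ 128 * y ^ 5 := by
    have h := abs_P3_le hz; rw [ha₃]; convert h using 2; ring
  have ht₀' : |s₀ - a₀| ≤ θ * (2 * y ^ 2) := abs_le.2 ⟨by linarith, ht₀⟩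
  -- the head value and `64y·P₀³`
  have hNa : -(a₀ * a₀ * a₃) - 3 * (a₀ * a₁ * a₂) + 2 * (a₁ * a₁ * a₁) =
      512 * y ^ 7 - 2304 * y ^ 6 + 2688 * y ^ 5 - 2880 * y ^ 4 := by
    rw [ha₀, ha₁, ha₂, ha₃]; ring
  have h64 : 64 * (y * a₀ ^ 3) = 512 * y ^ 7 - 2304 * y ^ 6 + 3456 * y ^ 5 - 1728 * y ^ 4 := by
    rw [ha₀]; ring
  -- the numeric heart of the lower envelope: `768y⁵ + 1152y⁴ + (tails) ≤ 64·10⁻⁶·y·P₀³ = 64·10⁻⁶·y⁴(2y − 3)³`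
  have h23 : 2531.8 ≤ 2 * y - 3 := by linarith
  have hsq : (2531.8 : ℝ) ^ 2 ≤ (2 * y - 3) ^ 2 := pow_le_pow_left₀ (by norm_num) h23 2
  have hK : 2531.8 ^ 2 * (2 * y - 3) ≤ (2 * y - 3) ^ 3 :=
    calc (2531.8 : ℝ) ^ 2 * (2 * y - 3) ≤ (2 * y - 3) ^ 2 * (2 * y - 3) :=
          mul_le_mul_of_nonneg_right hsq (by linarith)
      _ = (2 * y - 3) ^ 3 := by ring
  have hcub : 64 / 10 ^ 6 * (y ^ 4 * (2531.8 ^ 2 * (2 * y - 3))) ≤ 64 / 10 ^ 6 * (y * a₀ ^ 3) := by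
    have e : y * a₀ ^ 3 = y ^ 4 * (2 * y - 3) ^ 3 := by rw [ha₀]; ring
    rw [e]
    exact mul_le_mul_of_nonneg_left (mul_le_mul_of_nonneg_left hK hy4) (by norm_num)
  have hy5 : 1267.4 * y ^ 4 ≤ y ^ 5 := by nlinarith only [hy, hy4]
  have key : 768 * y ^ 5 + 1152 * y ^ 4 + 3584 * (θ * y ^ 7) + 21504 * (θ * y ^ 9) ≤
      64 / 10 ^ 6 * (y * a₀ ^ 3) := by
    linarith only [hcub, hy5, hθ7, hθ9, hy25, hy04, hy4]
  -- `(P₀ + e)³ ≤ P₀³ + 56θy⁶` for the tail allowance `e = 2θy²` of `s₀`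
  have hexp : (a₀ + θ * (2 * y ^ 2)) ^ 3 ≤ a₀ ^ 3 + 56 * θ * y ^ 6 := by
    set e := θ * (2 * y ^ 2) with he
    have i1 : a₀ ^ 2 * e ≤ (2 * y ^ 2) ^ 2 * e :=
      mul_le_mul_of_nonneg_right (pow_le_pow_left₀ ha0 ha2 2) he0
    have hee : e ^ 2 ≤ 2 * y ^ 2 * e := by rw [sq]; exact mul_le_mul_of_nonneg_right he2 he0
    have i2 : a₀ * e ^ 2 ≤ 2 * y ^ 2 * (2 * y ^ 2 * e) := mul_le_mul ha2 hee (sq_nonneg e) (by positivity)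
    have i3 : e ^ 3 ≤ (2 * y ^ 2) ^ 2 * e :=
      calc e ^ 3 = e ^ 2 * e := by ring
        _ ≤ (2 * y ^ 2) ^ 2 * e := mul_le_mul_of_nonneg_right (pow_le_pow_left₀ he0 he2 2) he0
    have ex : (a₀ + e) ^ 3 = a₀ ^ 3 + 3 * (a₀ ^ 2 * e) + 3 * (a₀ * e ^ 2) + e ^ 3 := by ring
    have ee : (2 * y ^ 2) ^ 2 * e = 8 * θ * y ^ 6 := by rw [he]; ring
    have ee2 : 2 * y ^ 2 * (2 * y ^ 2 * e) = 8 * θ * y ^ 6 := by rw [he]; ring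
    rw [ex]; linarith only [i1, i2, i3, ee, ee2]
  -- the three monomial perturbations, each of size `7θ·512y⁹`
  obtain ⟨p1l, p1u⟩ := abs_le.1 (abs_mul_three_sub_le hθ0 hθ1 hB₀ hB₀ hB₃ ht₀' ht₀' ht₃)
  obtain ⟨p2l, p2u⟩ := abs_le.1 (abs_mul_three_sub_le hθ0 hθ1 hB₀ hB₁ hB₂ ht₀' ht₁ ht₂)
  obtain ⟨p3l, p3u⟩ := abs_le.1 (abs_mul_three_sub_le hθ0 hθ1 hB₁ hB₁ hB₁ ht₁ ht₁ ht₁)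
  have eN : -(s₀ ^ 2 * s₃) - 3 * s₀ * s₁ * s₂ + 2 * s₁ ^ 3 =
      -(s₀ * s₀ * s₃) - 3 * (s₀ * s₁ * s₂) + 2 * (s₁ * s₁ * s₁) := by ring
  rw [eN]
  constructor
  · -- lower envelope
    have hcube : s₀ ^ 3 ≤ (a₀ + θ * (2 * y ^ 2)) ^ 3 := pow_le_pow_left₀ hs0 (by linarith) 3
    have hc2 : 64 * y * (1 - 1 / 10 ^ 6) * s₀ ^ 3 ≤ 64 * y * (1 - 1 / 10 ^ 6) * (a₀ ^ 3 + 56 * θ * y ^ 6) :=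
      mul_le_mul_of_nonneg_left (hcube.trans hexp) (by positivity)
    linarith only [hc2, key, p1l, p1u, p2l, p2u, p3l, p3u, hNa, h64, hθ70]
  · -- upper envelope
    have hcube : a₀ ^ 3 ≤ s₀ ^ 3 := pow_le_pow_left₀ ha0 (by linarith) 3
    have hc2 : 64 * y * a₀ ^ 3 ≤ 64 * y * s₀ ^ 3 := mul_le_mul_of_nonneg_left hcube (by positivity)
    linarith only [hc2, p1l, p1u, p2l, p2u, p3l, p3u, hNa, h64, hθ9, hy25, hy4, hy2]

/-- **(E4), algebraic core.** Same data plus `s₄` within `θ·512y⁶` of the head `P₄`: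
`256y·s₀⁴ ≤ N₄(s) ≤ 256y(1 + 10⁻⁶)·s₀⁴` for `N₄(s) = 6s₁⁴ − 12s₀s₁²s₂ + 3s₀²s₂² − 4s₀²s₁s₃ − s₀³s₄`
(head identity `N₄(P) = 256y⁵(2y − 3)⁴ + 1536y⁵(4y² + 24y + 9)`). -/
theorem envelope₄_core {y θ s₀ s₁ s₂ s₃ s₄ : ℝ} (hy : 1267.4 ≤ y) (hθ0 : 0 ≤ θ)
    (hθ7 : θ * y ^ 7 ≤ 1 / 10 ^ 6)
    (ht₀0 : 0 ≤ s₀ - (2 * y ^ 2 - 3 * y)) (ht₀ : s₀ - (2 * y ^ 2 - 3 * y) ≤ θ * (2 * y ^ 2))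
    (ht₁ : |s₁ - (8 * y ^ 3 - 30 * y ^ 2 + 15 * y)| ≤ θ * (8 * y ^ 3))
    (ht₂ : |s₂ - (32 * y ^ 4 - 224 * y ^ 3 + 330 * y ^ 2 - 75 * y)| ≤ θ * (32 * y ^ 4))
    (ht₃ : |s₃ - (-128 * y ^ 5 + 1440 * y ^ 4 - 4232 * y ^ 3 + 3270 * y ^ 2 - 375 * y)| ≤ θ * (128 * y ^ 5))
    (ht₄ : |s₄ - (512 * y ^ 6 - 8448 * y ^ 5 + 41408 * y ^ 4 - 68096 * y ^ 3 + 30930 * y ^ 2 - 1875 * y)| ≤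
      θ * (512 * y ^ 6)) :
    256 * y * s₀ ^ 4 ≤
        6 * s₁ ^ 4 - 12 * s₀ * s₁ ^ 2 * s₂ + 3 * s₀ ^ 2 * s₂ ^ 2 - 4 * s₀ ^ 2 * s₁ * s₃ - s₀ ^ 3 * s₄ ∧
      6 * s₁ ^ 4 - 12 * s₀ * s₁ ^ 2 * s₂ + 3 * s₀ ^ 2 * s₂ ^ 2 - 4 * s₀ ^ 2 * s₁ * s₃ - s₀ ^ 3 * s₄ ≤
        256 * y * (1 + 1 / 10 ^ 6) * s₀ ^ 4 := by
  set a₀ := 2 * y ^ 2 - 3 * y with ha₀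
  set a₁ := 8 * y ^ 3 - 30 * y ^ 2 + 15 * y with ha₁
  set a₂ := 32 * y ^ 4 - 224 * y ^ 3 + 330 * y ^ 2 - 75 * y with ha₂
  set a₃ := -128 * y ^ 5 + 1440 * y ^ 4 - 4232 * y ^ 3 + 3270 * y ^ 2 - 375 * y with ha₃
  set a₄ := 512 * y ^ 6 - 8448 * y ^ 5 + 41408 * y ^ 4 - 68096 * y ^ 3 + 30930 * y ^ 2 - 1875 * y with ha₄
  have hπ := Real.pi_lt_d2
  have hy1 : 1 ≤ y := by linarith
  have hy0 : 0 ≤ y := by linarith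
  have hz : 4 * π ≤ y := by linarith
  -- small numerical facts
  have hy7 : 1 ≤ y ^ 7 := one_le_pow₀ hy1
  have hθ1 : θ ≤ 1 := by nlinarith only [hθ7, hy7, hθ0]
  have hy2 : 0 ≤ y ^ 2 := sq_nonneg y
  have hy5 : 0 ≤ y ^ 5 := by positivity
  have hy6 : 0 ≤ y ^ 6 := by positivity
  have hy27 : y ^ 2 ≤ y ^ 7 := pow_le_pow_right₀ hy1 (by norm_num)
  have hy57 : y ^ 5 ≤ y ^ 7 := pow_le_pow_right₀ hy1 (by norm_num)
  have hθ9 : θ * y ^ 9 ≤ 1 / 10 ^ 6 * y ^ 2 :=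
    calc θ * y ^ 9 = θ * y ^ 7 * y ^ 2 := by ring
      _ ≤ 1 / 10 ^ 6 * y ^ 2 := mul_le_mul_of_nonneg_right hθ7 hy2
  have hθ12 : θ * y ^ 12 ≤ 1 / 10 ^ 6 * y ^ 5 :=
    calc θ * y ^ 12 = θ * y ^ 7 * y ^ 5 := by ring
      _ ≤ 1 / 10 ^ 6 * y ^ 5 := mul_le_mul_of_nonneg_right hθ7 hy5
  have he0 : 0 ≤ θ * (2 * y ^ 2) := by positivity
  have he2 : θ * (2 * y ^ 2) ≤ 2 * y ^ 2 := by nlinarith only [hθ1, hy2]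
  have ha0 : 0 ≤ a₀ := by
    have : 0 ≤ y * (2 * y - 3) := mul_nonneg hy0 (by linarith)
    rw [ha₀]; linarith
  have ha2 : a₀ ≤ 2 * y ^ 2 := by rw [ha₀]; linarith
  have hs0 : 0 ≤ s₀ := by linarith
  -- head sizes
  have hB₀ : |a₀| ≤ 2 * y ^ 2 := by
    have h := abs_P0_le hz; rw [ha₀]; convert h using 2; ring
  have hB₁ : |a₁| ≤ 8 * y ^ 3 := by
    have h := abs_P1_le hz; rw [ha₁]; convert h using 2; ring
  have hB₂ : |a₂| ≤ 32 * y ^ 4 := by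
    have h := abs_P2_le hz; rw [ha₂]; convert h using 2; ring
  have hB₃ : |a₃| ≤ 128 * y ^ 5 := by
    have h := abs_P3_le hz; rw [ha₃]; convert h using 2; ring
  have hB₄ : |a₄| ≤ 512 * y ^ 6 := by
    have h := abs_P4_le hz; rw [ha₄]; convert h using 2; ring
  have ht₀' : |s₀ - a₀| ≤ θ * (2 * y ^ 2) := abs_le.2 ⟨by linarith, ht₀⟩
  -- the head value and `256y·P₀⁴`
  have hNa : 6 * (a₁ * a₁ * a₁ * a₁) - 12 * (a₀ * a₁ * a₁ * a₂) + 3 * (a₀ * a₀ * a₂ * a₂) -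
      4 * (a₀ * a₀ * a₁ * a₃) - a₀ * a₀ * a₀ * a₄ =
      4096 * y ^ 9 - 24576 * y ^ 8 + 61440 * y ^ 7 - 18432 * y ^ 6 + 34560 * y ^ 5 := by
    rw [ha₀, ha₁, ha₂, ha₃, ha₄]; ring
  have h256 : 256 * (y * a₀ ^ 4) =
      4096 * y ^ 9 - 24576 * y ^ 8 + 55296 * y ^ 7 - 55296 * y ^ 6 + 20736 * y ^ 5 := by
    rw [ha₀]; ring
  -- the numeric heart of the upper envelope: `1536y⁵(4y² + 24y + 9) + (tails) ≤ 256·10⁻⁶·y⁵(2y − 3)⁴`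
  have h23 : 2531.8 ≤ 2 * y - 3 := by linarith
  have hsq : (2531.8 : ℝ) ^ 2 ≤ (2 * y - 3) ^ 2 := pow_le_pow_left₀ (by norm_num) h23 2
  have h4 : (2531.8 : ℝ) ^ 2 * (2 * y - 3) ^ 2 ≤ (2 * y - 3) ^ 4 :=
    calc (2531.8 : ℝ) ^ 2 * (2 * y - 3) ^ 2 ≤ (2 * y - 3) ^ 2 * (2 * y - 3) ^ 2 :=
          mul_le_mul_of_nonneg_right hsq (sq_nonneg _)
      _ = (2 * y - 3) ^ 4 := by ring
  have hyy : 1267.4 * y ≤ y ^ 2 := by nlinarith only [hy, hy0]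
  have hbr : 0 ≤ 256 / 10 ^ 6 * (2 * y - 3) ^ 4 - 1536 * (4 * y ^ 2 + 24 * y + 9) - 1.59744 := by
    linarith only [h4, hyy, hy]
  have hya : y * a₀ ^ 4 = y ^ 5 * (2 * y - 3) ^ 4 := by rw [ha₀]; ring
  have key : 1536 * (y ^ 5 * (4 * y ^ 2 + 24 * y + 9)) + 1597440 * (θ * y ^ 12) ≤
      256 / 10 ^ 6 * (y * a₀ ^ 4) := by
    rw [hya]; linarith only [mul_nonneg hy5 hbr, hθ12]
  -- `(P₀ + e)⁴ ≤ P₀⁴ + 240θy⁸` for the tail allowance `e = 2θy²` of `s₀`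
  have hexp : (a₀ + θ * (2 * y ^ 2)) ^ 4 ≤ a₀ ^ 4 + 240 * θ * y ^ 8 := by
    set e := θ * (2 * y ^ 2) with he
    have hB : 0 ≤ 2 * y ^ 2 := by positivity
    have i1 : a₀ ^ 3 * e ≤ (2 * y ^ 2) ^ 3 * e :=
      mul_le_mul_of_nonneg_right (pow_le_pow_left₀ ha0 ha2 3) he0
    have hee : e ^ 2 ≤ 2 * y ^ 2 * e := by rw [sq]; exact mul_le_mul_of_nonneg_right he2 he0
    have i2 : a₀ ^ 2 * e ^ 2 ≤ (2 * y ^ 2) ^ 2 * (2 * y ^ 2 * e) :=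
      mul_le_mul (pow_le_pow_left₀ ha0 ha2 2) hee (sq_nonneg e) (by positivity)
    have he3 : e ^ 3 ≤ (2 * y ^ 2) ^ 2 * e :=
      calc e ^ 3 = e ^ 2 * e := by ring
        _ ≤ (2 * y ^ 2) ^ 2 * e := mul_le_mul_of_nonneg_right (pow_le_pow_left₀ he0 he2 2) he0
    have i3 : a₀ * e ^ 3 ≤ 2 * y ^ 2 * ((2 * y ^ 2) ^ 2 * e) := mul_le_mul ha2 he3 (pow_nonneg he0 3) hB
    have i4 : e ^ 4 ≤ (2 * y ^ 2) ^ 3 * e :=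
      calc e ^ 4 = e ^ 3 * e := by ring
        _ ≤ (2 * y ^ 2) ^ 3 * e := mul_le_mul_of_nonneg_right (pow_le_pow_left₀ he0 he2 3) he0
    have ex : (a₀ + e) ^ 4 = a₀ ^ 4 + 4 * (a₀ ^ 3 * e) + 6 * (a₀ ^ 2 * e ^ 2) + 4 * (a₀ * e ^ 3) + e ^ 4 := by
      ring
    have ee : (2 * y ^ 2) ^ 3 * e = 16 * θ * y ^ 8 := by rw [he]; ring
    have ee2 : (2 * y ^ 2) ^ 2 * (2 * y ^ 2 * e) = 16 * θ * y ^ 8 := by rw [he]; ring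
    have ee3 : 2 * y ^ 2 * ((2 * y ^ 2) ^ 2 * e) = 16 * θ * y ^ 8 := by rw [he]; ring
    rw [ex]; linarith only [i1, i2, i3, i4, ee, ee2, ee3]
  -- the five monomial perturbations, each of size `15θ·4096y¹²`
  obtain ⟨p1l, p1u⟩ := abs_le.1 (abs_mul_four_sub_le hθ0 hθ1 hB₁ hB₁ hB₁ hB₁ ht₁ ht₁ ht₁ ht₁)
  obtain ⟨p2l, p2u⟩ := abs_le.1 (abs_mul_four_sub_le hθ0 hθ1 hB₀ hB₁ hB₁ hB₂ ht₀' ht₁ ht₁ ht₂)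
  obtain ⟨p3l, p3u⟩ := abs_le.1 (abs_mul_four_sub_le hθ0 hθ1 hB₀ hB₀ hB₂ hB₂ ht₀' ht₀' ht₂ ht₂)
  obtain ⟨p4l, p4u⟩ := abs_le.1 (abs_mul_four_sub_le hθ0 hθ1 hB₀ hB₀ hB₁ hB₃ ht₀' ht₀' ht₁ ht₃)
  obtain ⟨p5l, p5u⟩ := abs_le.1 (abs_mul_four_sub_le hθ0 hθ1 hB₀ hB₀ hB₀ hB₄ ht₀' ht₀' ht₀' ht₄)
  have eN : 6 * s₁ ^ 4 - 12 * s₀ * s₁ ^ 2 * s₂ + 3 * s₀ ^ 2 * s₂ ^ 2 - 4 * s₀ ^ 2 * s₁ * s₃ - s₀ ^ 3 * s₄ =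
      6 * (s₁ * s₁ * s₁ * s₁) - 12 * (s₀ * s₁ * s₁ * s₂) + 3 * (s₀ * s₀ * s₂ * s₂) -
      4 * (s₀ * s₀ * s₁ * s₃) - s₀ * s₀ * s₀ * s₄ := by ring
  rw [eN]
  constructor
  · -- lower envelope: `256y·s₀⁴ ≤ 256y(P₀ + 2θy²)⁴ ≤ 256y·P₀⁴ + 61440θy⁹ ≤ N₄(P) − (tails) ≤ N₄(s)`
    have hfour : s₀ ^ 4 ≤ (a₀ + θ * (2 * y ^ 2)) ^ 4 := pow_le_pow_left₀ hs0 (by linarith) 4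
    have hc2 : 256 * y * s₀ ^ 4 ≤ 256 * y * (a₀ ^ 4 + 240 * θ * y ^ 8) :=
      mul_le_mul_of_nonneg_left (hfour.trans hexp) (by positivity)
    linarith only [hc2, p1l, p1u, p2l, p2u, p3l, p3u, p4l, p4u, p5l, p5u, hNa, h256, hθ9, hθ12, hy27, hy57, hy5, hy6]
  · -- upper envelope: `N₄(s) ≤ N₄(P) + (tails) ≤ 256y(1 + 10⁻⁶)P₀⁴ ≤ 256y(1 + 10⁻⁶)s₀⁴`
    have hfour : a₀ ^ 4 ≤ s₀ ^ 4 := pow_le_pow_left₀ ha0 (by linarith) 4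
    have hc2 : 256 * y * (1 + 1 / 10 ^ 6) * a₀ ^ 4 ≤ 256 * y * (1 + 1 / 10 ^ 6) * s₀ ^ 4 :=
      mul_le_mul_of_nonneg_left hfour (by positivity)
    linarith only [hc2, key, p1l, p1u, p2l, p2u, p3l, p3u, p4l, p4u, p5l, p5u, hNa, h256]

end Summit.RiemannHypothesis.RiemannHypothesis.Theorems.JensenPolynomials

end
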